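import Summits.AtomisticToContinuum.Crystallization.Theorems.PalmUnimodularRigidityLayeredLawsSelectHcpRelaxedReference
import Summits.AtomisticToContinuum.Crystallization.Theorems.ExcessDecayLiouvilleCoarseGrainsHcpEnergySeries
import Summits.AtomisticToContinuum.Crystallization.Theorems.ExcessDecayLiouvilleCoarseGrainsPinNumerics
import Literature.MathematicalPhysics.StatisticalMechanics.BarlowStacking

/-!
# `StackingHinge` (stmt-AtomisticToContinuum-14993), line `Sketch`: stub `stub_boxModulusOfShape`

The assembly step m3′c of the zeroth-order SCALE price: a quadratic modulus of the shape function
`G = S₃²/S₆` of the certified hcp lattice sums `S_n = hcpSumS n` about its global maximiser `c₀`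
(first hypothesis) and a Lipschitz constant `L` of the dilation ratio `r = S₃/S₆` on the box
`[39/50, 17/20]` (second hypothesis) give a quadratic modulus of
`(a, h) ↦ e(hcp a h) = (hcpPeriodicConfiguration ha hh).energyPerParticle lennardJones` on the box
`B = {47/50 ≤ a ≤ 1, 39/50·a ≤ h ≤ 17/20·a}` about the point `(a₀, h₀) = (a₀, a₀ c₀)`,
`a₀⁶ = S₆(c₀)/S₃(c₀)`.

Proof (pure algebra on the landed identities).  With `c = h/a ∈ [39/50, 17/20]`,
`e(hcp a h) = hcpE a (a c)` (`hcpEnergySeries_of_eq`, third clause)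
`= ½((1/12)a⁻¹²S₆(c) − (1/6)a⁻⁶S₃(c))` (`hcpE_eq_hcpSumS`) `= S₆ u²/(24 a¹²) − G(c)/24` with
`u = 1 − r(c) a⁶`, while `e(hcp a₀ h₀) = −G(c₀)/24` (`hcpPinC_dilation_value`); `hcpSum_main` puts
`a₀` in `[0.945, 0.995]`.  Hence `e − e₀ ≥ u²/24 + μ(c − c₀)²/24` (`S₆ ≥ 1`, `a ≤ 1`), and the
kinematics `r(c₀)(a₀⁶ − a⁶) = u − (r(c₀) − r(c)) a⁶`, `r(c₀) = a₀⁻⁶ ≥ 1`,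
`(a₀⁶ − a⁶)² ≥ (a₀ − a)²`, `(h − h₀)² ≤ 2(c − c₀)² + 2(a − a₀)²` give
`(a − a₀)² + (h − h₀)² ≤ 6u² + (6L² + 2)(c − c₀)²`, so `κ = min (1/144) (μ/(144 L² + 48))` works.
All `[folklore]`.
-/

noncomputable section

namespace Summit.AtomisticToContinuum.Crystallization.Theorems.PricedHcpWindowsBoxModulus

open Literature.MathematicalPhysics.StatisticalMechanics
open Summit.AtomisticToContinuum.Crystallization.Theorems.ExcessDecayLiouvilleCoarseGrains
  (hcpSumS hcpEnergySeries_of_eq hcpPinC_dilation_value hcpSum_main)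
open Summit.AtomisticToContinuum.Crystallization.Theorems.PalmUnimodularRigidity.LayeredLawsSelectHcp
  (hcpQ hcpE hcpE_eq_hcpSumS hcpSumS_pos' hcpSum_one_le_hcpSumS_gen)

/-! ## Scalar algebra -/

/-- The energy at `(a, a c)` as a complete square plus the shape term:
`½((1/12)a⁻¹²s₆ − (1/6)a⁻⁶s₃) = s₆ u²/(24 a¹²) − (s₃²/s₆)/24`, `u = 1 − (s₃/s₆)a⁶`. [folklore] -/
theorem boxmod_energy_sq_identity {s3 s6 a : ℝ} (ha : a ≠ 0) (hs6 : s6 ≠ 0) :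
    1 / 2 * ((1 / 12) * (a ^ 12)⁻¹ * s6 - (1 / 6) * (a ^ 6)⁻¹ * s3) =
      s6 * (1 - s3 / s6 * a ^ 6) ^ 2 / (24 * a ^ 12) - s3 ^ 2 / s6 / 24 := by
  field_simp
  ring

/-- The complete square dominates `u²/24` when `s₆ ≥ 1` and `0 < a ≤ 1`. [folklore] -/
theorem boxmod_sq_term_lower {s6 a u : ℝ} (hs6 : 1 ≤ s6) (ha : 0 < a) (ha1 : a ≤ 1) :
    u ^ 2 / 24 ≤ s6 * u ^ 2 / (24 * a ^ 12) := by
  have ha12 : a ^ 12 ≤ 1 := pow_le_one₀ ha.le ha1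
  rw [div_le_div_iff₀ (by norm_num) (by positivity)]
  nlinarith [mul_le_mul_of_nonneg_left ha12 (sq_nonneg u),
    mul_le_mul_of_nonneg_left hs6 (sq_nonneg u)]

/-- Sixth powers separate points of `[47/50, ∞)` at unit rate (crudely): `(a − a₀)² ≤ (a₀⁶ − a⁶)²`.
[folklore] -/
theorem boxmod_sq_sub_le_sq_pow_six_sub {a a₀ : ℝ} (hal : 47 / 50 ≤ a) (ha₀l : 47 / 50 ≤ a₀) :
    (a - a₀) ^ 2 ≤ (a₀ ^ 6 - a ^ 6) ^ 2 := by
  have ha : 0 ≤ a := by linarith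
  have ha₀ : 0 ≤ a₀ := by linarith
  have hfac : a₀ ^ 6 - a ^ 6 = (a₀ - a) *
      (a₀ ^ 5 + a₀ ^ 4 * a + a₀ ^ 3 * a ^ 2 + a₀ ^ 2 * a ^ 3 + a₀ * a ^ 4 + a ^ 5) := by ring
  have h5 : (1 / 2 : ℝ) ≤ (47 / 50 : ℝ) ^ 5 := by norm_num
  have t0 : (47 / 50 : ℝ) ^ 5 ≤ a₀ ^ 5 := pow_le_pow_left₀ (by norm_num) ha₀l 5
  have t5 : (47 / 50 : ℝ) ^ 5 ≤ a ^ 5 := pow_le_pow_left₀ (by norm_num) hal 5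
  have hmix : 0 ≤ a₀ ^ 4 * a + a₀ ^ 3 * a ^ 2 + a₀ ^ 2 * a ^ 3 + a₀ * a ^ 4 := by positivity
  have hP1 : 1 ≤ a₀ ^ 5 + a₀ ^ 4 * a + a₀ ^ 3 * a ^ 2 + a₀ ^ 2 * a ^ 3 + a₀ * a ^ 4 + a ^ 5 := by
    linarith
  rw [hfac]
  have key : 0 ≤ (a₀ - a) ^ 2 *
      ((a₀ ^ 5 + a₀ ^ 4 * a + a₀ ^ 3 * a ^ 2 + a₀ ^ 2 * a ^ 3 + a₀ * a ^ 4 + a ^ 5 - 1) *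
        (a₀ ^ 5 + a₀ ^ 4 * a + a₀ ^ 3 * a ^ 2 + a₀ ^ 2 * a ^ 3 + a₀ * a ^ 4 + a ^ 5 + 1)) :=
    mul_nonneg (sq_nonneg _) (mul_nonneg (by linarith) (by linarith))
  nlinarith [key]

/-- Layer-spacing kinematics: `(a c − a₀ c₀)² ≤ 2(c − c₀)² + 2(a − a₀)²` for `a, c₀ ∈ [0, 1]`.
[folklore] -/
theorem boxmod_layer_sq_le {a a₀ c c₀ : ℝ} (ha0 : 0 ≤ a) (ha1 : a ≤ 1) (hc0 : 0 ≤ c₀)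
    (hc1 : c₀ ≤ 1) : (a * c - a₀ * c₀) ^ 2 ≤ 2 * (c - c₀) ^ 2 + 2 * (a - a₀) ^ 2 := by
  have h1 : a ^ 2 ≤ 1 := pow_le_one₀ ha0 ha1
  have h2 : c₀ ^ 2 ≤ 1 := pow_le_one₀ hc0 hc1
  have hx : (a * (c - c₀)) ^ 2 ≤ (c - c₀) ^ 2 := by
    rw [mul_pow]; exact mul_le_of_le_one_left (sq_nonneg _) h1
  have hy : (c₀ * (a - a₀)) ^ 2 ≤ (a - a₀) ^ 2 := by
    rw [mul_pow]; exact mul_le_of_le_one_left (sq_nonneg _) h2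
  have hid : a * c - a₀ * c₀ = a * (c - c₀) + c₀ * (a - a₀) := by ring
  rw [hid]
  nlinarith [sq_nonneg (a * (c - c₀) - c₀ * (a - a₀))]

/-- Dilation kinematics: with `a₀⁶ = s₆₀/s₃₀`, `a, a₀ ∈ [47/50, 1]` and the Lipschitz bound on the
ratio, `(a − a₀)² ≤ 2u² + 2L²(c − c₀)²`, `u = 1 − (s₃/s₆)a⁶`. [folklore] -/
theorem boxmod_dilation_kinematics {s3 s6 s30 s60 a a₀ c c₀ L : ℝ} (hs30 : 0 < s30)
    (hs60 : 0 < s60) (ha6 : a₀ ^ 6 = s60 / s30) (ha₀l : 47 / 50 ≤ a₀) (ha₀u : a₀ ≤ 1)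
    (hal : 47 / 50 ≤ a) (hau : a ≤ 1) (hlip : |s30 / s60 - s3 / s6| ≤ L * |c₀ - c|) :
    (a - a₀) ^ 2 ≤ 2 * (1 - s3 / s6 * a ^ 6) ^ 2 + 2 * (L ^ 2 * (c - c₀) ^ 2) := by
  have ha : 0 ≤ a := by linarith
  have hr0a : s30 / s60 * a₀ ^ 6 = 1 := by
    rw [ha6]; field_simp
  have hr0pos : 0 < s30 / s60 := div_pos hs30 hs60
  have hr0 : 1 ≤ s30 / s60 := by
    have ha6le : a₀ ^ 6 ≤ 1 := pow_le_one₀ (by linarith) ha₀u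
    nlinarith
  -- the squared Lipschitz bound
  have hsq : (s30 / s60 - s3 / s6) ^ 2 ≤ L ^ 2 * (c - c₀) ^ 2 := by
    have h1 : |s30 / s60 - s3 / s6| ^ 2 ≤ (L * |c₀ - c|) ^ 2 :=
      pow_le_pow_left₀ (abs_nonneg _) hlip 2
    rw [sq_abs, mul_pow, sq_abs] at h1
    linarith [show (c₀ - c) ^ 2 = (c - c₀) ^ 2 by ring]
  have ha12 : a ^ 12 ≤ 1 := pow_le_one₀ ha hau
  have hdecomp : s30 / s60 * (a₀ ^ 6 - a ^ 6) =
      (1 - s3 / s6 * a ^ 6) - (s30 / s60 - s3 / s6) * a ^ 6 := by linear_combination hr0a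
  have hv : ((s30 / s60 - s3 / s6) * a ^ 6) ^ 2 ≤ L ^ 2 * (c - c₀) ^ 2 := by
    have hv' : ((s30 / s60 - s3 / s6) * a ^ 6) ^ 2 = (s30 / s60 - s3 / s6) ^ 2 * a ^ 12 := by ring
    rw [hv']
    calc (s30 / s60 - s3 / s6) ^ 2 * a ^ 12 ≤ (s30 / s60 - s3 / s6) ^ 2 * 1 :=
          mul_le_mul_of_nonneg_left ha12 (sq_nonneg _)
      _ ≤ L ^ 2 * (c - c₀) ^ 2 := by rw [mul_one]; exact hsq
  have hstep : (s30 / s60 * (a₀ ^ 6 - a ^ 6)) ^ 2 ≤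
      2 * (1 - s3 / s6 * a ^ 6) ^ 2 + 2 * (L ^ 2 * (c - c₀) ^ 2) := by
    rw [hdecomp]
    nlinarith [sq_nonneg ((1 - s3 / s6 * a ^ 6) + (s30 / s60 - s3 / s6) * a ^ 6), hv]
  have hK2 := boxmod_sq_sub_le_sq_pow_six_sub hal ha₀l
  have hr0sq : (a₀ ^ 6 - a ^ 6) ^ 2 ≤ (s30 / s60 * (a₀ ^ 6 - a ^ 6)) ^ 2 := by
    have hnn : 0 ≤ (s30 / s60 - 1) * (s30 / s60 + 1) * (a₀ ^ 6 - a ^ 6) ^ 2 :=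
      mul_nonneg (mul_nonneg (by linarith) (by linarith)) (sq_nonneg _)
    nlinarith [hnn]
  linarith

/-- **The scalar assembly.** With `s₃, s₆` the sums at `c`, `s₃₀, s₆₀` at `c₀`, `a₀⁶ = s₆₀/s₃₀`, the
shape modulus and the ratio Lipschitz bound, the box modulus inequality for the closed-form energies
`−s₃₀²/(24 s₆₀) + κ((a − a₀)² + (a c − a₀ c₀)²) ≤ ½((1/12)a⁻¹²s₆ − (1/6)a⁻⁶s₃)` holds for every
`0 ≤ κ ≤ min (1/144) (μ/(144 L² + 48))`. [folklore] -/
theorem boxmod_alg {s3 s6 s30 s60 a a₀ c c₀ μ L κ : ℝ}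
    (hs6 : 1 ≤ s6) (hs30 : 0 < s30) (hs60 : 0 < s60) (ha6 : a₀ ^ 6 = s60 / s30)
    (ha₀l : 47 / 50 ≤ a₀) (ha₀u : a₀ ≤ 1) (hal : 47 / 50 ≤ a) (hau : a ≤ 1)
    (hc₀0 : 0 ≤ c₀) (hc₀1 : c₀ ≤ 1)
    (hmod : s3 ^ 2 / s6 + μ * (c - c₀) ^ 2 ≤ s30 ^ 2 / s60)
    (hlip : |s30 / s60 - s3 / s6| ≤ L * |c₀ - c|)
    (hκ0 : 0 ≤ κ) (hκ1 : κ ≤ 1 / 144) (hκ2 : κ ≤ μ / (144 * L ^ 2 + 48)) :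
    -(s30 ^ 2 / (24 * s60)) + κ * ((a - a₀) ^ 2 + (a * c - a₀ * c₀) ^ 2) ≤
      1 / 2 * ((1 / 12) * (a ^ 12)⁻¹ * s6 - (1 / 6) * (a ^ 6)⁻¹ * s3) := by
  have ha : 0 < a := by linarith
  have hs6' : 0 < s6 := by linarith
  rw [boxmod_energy_sq_identity ha.ne' hs6'.ne']
  have hX := boxmod_sq_term_lower (u := 1 - s3 / s6 * a ^ 6) hs6 ha hau
  have hK := boxmod_dilation_kinematics (c := c) (c₀ := c₀) hs30 hs60 ha6 ha₀l ha₀u hal hau hlip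
  have hH := boxmod_layer_sq_le (c := c) (a₀ := a₀) ha.le hau hc₀0 hc₀1
  have hD : (a - a₀) ^ 2 + (a * c - a₀ * c₀) ^ 2 ≤
      6 * (1 - s3 / s6 * a ^ 6) ^ 2 + (6 * L ^ 2 + 2) * (c - c₀) ^ 2 := by linarith
  have h1 : κ * (6 * (1 - s3 / s6 * a ^ 6) ^ 2) ≤ (1 - s3 / s6 * a ^ 6) ^ 2 / 24 := by
    nlinarith [sq_nonneg (1 - s3 / s6 * a ^ 6)]
  have h2 : κ * ((6 * L ^ 2 + 2) * (c - c₀) ^ 2) ≤ μ / 24 * (c - c₀) ^ 2 := by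
    have hpos : 0 < 144 * L ^ 2 + 48 := by positivity
    have hκμ : κ * (144 * L ^ 2 + 48) ≤ μ := (le_div_iff₀ hpos).1 hκ2
    have hcc : 0 ≤ (c - c₀) ^ 2 := sq_nonneg _
    nlinarith [mul_le_mul_of_nonneg_right hκμ hcc]
  have G0eq : s30 ^ 2 / (24 * s60) = s30 ^ 2 / s60 / 24 := by rw [div_div, mul_comm]
  rw [G0eq]
  nlinarith [mul_le_mul_of_nonneg_left hD hκ0, hX, h1, h2, hmod]

/-! ## The statement -/

/-- **Stub `stub_boxModulusOfShape` of line `Sketch` (crux `PricedLinkCensus.StackingHinge`,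
stmt-AtomisticToContinuum-14993): SHAPE MODULUS + RATIO LIPSCHITZ ⇒ BOX MODULUS OF `e(hcp a h)`.**
Given a global maximiser `c₀ ∈ (39/50, 17/20)` of the shape function `S₃²/S₆` with a quadratic
modulus `μ` on `[39/50, 17/20]`, and a Lipschitz constant `L` of `S₃/S₆` there, the energy per
particle of relaxed hcp has a quadratic modulus on the box `{47/50 ≤ a ≤ 1, 39/50·a ≤ h ≤ 17/20·a}`
about `(a₀, a₀ c₀)`, `a₀⁶ = S₆(c₀)/S₃(c₀) ∈ [0.945⁶, 0.995⁶]` (`hcpSum_main`): the closed forms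
`hcpEnergySeries_of_eq`, `hcpE_eq_hcpSumS`, `hcpPinC_dilation_value` and the scalar assembly
`boxmod_alg` with `κ = min (1/144) (μ/(144 L² + 48))`. [folklore] -/
theorem stub_boxModulusOfShape : (∃ c₀ μ : ℝ, 39 / 50 < c₀ ∧ c₀ < 17 / 20 ∧ 0 < μ ∧ (∀ c : ℝ, 0 < c → Summit.AtomisticToContinuum.Crystallization.Theorems.ExcessDecayLiouvilleCoarseGrains.hcpSumS 3 c ^ 2 / Summit.AtomisticToContinuum.Crystallization.Theorems.ExcessDecayLiouvilleCoarseGrains.hcpSumS 6 c ≤ Summit.AtomisticToContinuum.Crystallization.Theorems.ExcessDecayLiouvilleCoarseGrains.hcpSumS 3 c₀ ^ 2 / Summit.AtomisticToContinuum.Crystallization.Theorems.ExcessDecayLiouvilleCoarseGrains.hcpSumS 6 c₀) ∧ ∀ c : ℝ, 39 / 50 ≤ c → c ≤ 17 / 20 → Summit.AtomisticToContinuum.Crystallization.Theorems.ExcessDecayLiouvilleCoarseGrains.hcpSumS 3 c ^ 2 / Summit.AtomisticToContinuum.Crystallization.Theorems.ExcessDecayLiouvilleCoarseGrains.hcpSumS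 6 c + μ * (c - c₀) ^ 2 ≤ Summit.AtomisticToContinuum.Crystallization.Theorems.ExcessDecayLiouvilleCoarseGrains.hcpSumS 3 c₀ ^ 2 / Summit.AtomisticToContinuum.Crystallization.Theorems.ExcessDecayLiouvilleCoarseGrains.hcpSumS 6 c₀) → (∃ L : ℝ, 0 ≤ L ∧ ∀ c c' : ℝ, 39 / 50 ≤ c → c ≤ 17 / 20 → 39 / 50 ≤ c' → c' ≤ 17 / 20 → |Summit.AtomisticToContinuum.Crystallization.Theorems.ExcessDecayLiouvilleCoarseGrains.hcpSumS 3 c / Summit.AtomisticToContinuum.Crystallization.Theorems.ExcessDecayLiouvilleCoarseGrains.hcpSumS 6 c - Summit.AtomisticToContinuum.Crystallization.Theorems.ExcessDecayLiouvilleCoarseGrains.hcpSumS 3 c' / Summit.AtomisticToContinuum.Crystallization.Theorems.ExcessDecayLiouvilleCoarseGrains.hcpSumS 6 c'| ≤ L * |c - c'|) → ∃ (a₀ h₀ : ℝ) (ha₀ : a₀ ≠ 0) (hh₀ : h₀ ≠ 0) (c : ℝ), 0 < c ∧ (47 / 50 ≤ a₀ ∧ a₀ ≤ 1 ∧ 39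 / 50 * a₀ ≤ h₀ ∧ h₀ ≤ 17 / 20 * a₀) ∧ ∀ (a h : ℝ) (ha : a ≠ 0) (hh : h ≠ 0), 47 / 50 ≤ a ∧ a ≤ 1 ∧ 39 / 50 * a ≤ h ∧ h ≤ 17 / 20 * a → (Literature.MathematicalPhysics.StatisticalMechanics.hcpPeriodicConfiguration ha₀ hh₀).energyPerParticle Literature.MathematicalPhysics.StatisticalMechanics.lennardJones + c * ((a - a₀) ^ 2 + (h - h₀) ^ 2) ≤ (Literature.MathematicalPhysics.StatisticalMechanics.hcpPeriodicConfiguration ha hh).energyPerParticle Literature.MathematicalPhysics.StatisticalMechanics.lennardJones := by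
  rintro ⟨c₀, μ, hc₀l, hc₀r, hμ, hglob, hmod⟩ ⟨L, -, hLip⟩
  have hc₀pos : (0 : ℝ) < c₀ := by linarith
  have hbox : ∀ c', 39 / 50 ≤ c' → c' ≤ 17 / 20 →
      hcpSumS 3 c' ^ 2 / hcpSumS 6 c' ≤ hcpSumS 3 c₀ ^ 2 / hcpSumS 6 c₀ :=
    fun c' h1 _ => hglob c' (by linarith)
  obtain ⟨hb1, hb2, -, -⟩ := hcpSum_main c₀ hc₀l.le hc₀r.le hbox
  have hS3 := hcpSumS_pos' (le_refl 3) hc₀pos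
  have hS6 := hcpSumS_pos' (by norm_num : 3 ≤ 6) hc₀pos
  have hq : 0 < hcpSumS 6 c₀ / hcpSumS 3 c₀ := div_pos hS6 hS3
  obtain ⟨a₀, ha₀, ha6⟩ : ∃ b : ℝ, 0 < b ∧ b ^ 6 = hcpSumS 6 c₀ / hcpSumS 3 c₀ :=
    ⟨(hcpSumS 6 c₀ / hcpSumS 3 c₀) ^ ((6 : ℕ) : ℝ)⁻¹, Real.rpow_pos_of_pos hq _,
      Real.rpow_inv_natCast_pow hq.le (by norm_num)⟩
  rw [← ha6] at hb1 hb2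
  have h6ne : (6 : ℕ) ≠ 0 := by norm_num
  have ha₀l : 189 / 200 ≤ a₀ := (pow_le_pow_iff_left₀ (by norm_num) ha₀.le h6ne).1 hb1
  have ha₀u : a₀ ≤ 199 / 200 := (pow_le_pow_iff_left₀ ha₀.le (by norm_num) h6ne).1 hb2
  have ha₀ne : a₀ ≠ 0 := ha₀.ne'
  have hh₀ne : a₀ * c₀ ≠ 0 := (mul_pos ha₀ hc₀pos).ne'
  have hκpos : 0 < min (1 / 144) (μ / (144 * L ^ 2 + 48)) :=
    lt_min (by norm_num) (div_pos hμ (by positivity))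
  refine ⟨a₀, a₀ * c₀, ha₀ne, hh₀ne, min (1 / 144) (μ / (144 * L ^ 2 + 48)), hκpos,
    ⟨by linarith, by linarith, by nlinarith, by nlinarith⟩, ?_⟩
  rintro a h ha hh ⟨h1, h2, h3, h4⟩
  have hapos : (0 : ℝ) < a := by linarith
  obtain ⟨c, rfl⟩ : ∃ c, h = a * c := ⟨h / a, by field_simp⟩
  have hc1 : 39 / 50 ≤ c := le_of_mul_le_mul_left (by linarith : a * (39 / 50) ≤ a * c) hapos
  have hc2 : c ≤ 17 / 20 := le_of_mul_le_mul_left (by linarith : a * c ≤ a * (17 / 20)) hapos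
  have hcpos : (0 : ℝ) < c := by linarith
  have hE : (hcpPeriodicConfiguration ha hh).energyPerParticle lennardJones = hcpE a (a * c) :=
    (hcpEnergySeries_of_eq a (a * c) ha hh hcpQ rfl).2.2
  have hE₀ : (hcpPeriodicConfiguration ha₀ne hh₀ne).energyPerParticle lennardJones =
      hcpE a₀ (a₀ * c₀) :=
    (hcpEnergySeries_of_eq a₀ (a₀ * c₀) ha₀ne hh₀ne hcpQ rfl).2.2
  rw [hE, hE₀, hcpE_eq_hcpSumS ha hcpos.ne', hcpE_eq_hcpSumS ha₀ne hc₀pos.ne',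
    hcpPinC_dilation_value hS3 hS6 ha6]
  exact boxmod_alg (hcpSum_one_le_hcpSumS_gen (by norm_num) hcpos) hS3 hS6 ha6 (by linarith)
    (by linarith) h1 h2 hc₀pos.le (by linarith) (hmod c hc1 hc2)
    (hLip c₀ c hc₀l.le hc₀r.le hc1 hc2) hκpos.le (min_le_left _ _) (min_le_right _ _)

end Summit.AtomisticToContinuum.Crystallization.Theorems.PricedHcpWindowsBoxModulus

end
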